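import Mathlib
import HarnessLib
import Literature.MathematicalPhysics.KineticTheory.HardSphereEulerProofs
import Literature.MathematicalPhysics.KineticTheory.HardSphereBBGKYLiouvilleFlow
import Literature.MathematicalPhysics.KineticTheory.HardSphereTwoTimePressure
import Literature.Analysis.FluidPDE.HardSphereTrajectoryMeasurable
import Literature.Analysis.FluidPDE.HardSphereFlowJointMeasurable
import Literature.Analysis.FluidPDE.HardSphereTorusMeasure
import Summits.AtomisticToContinuum.HydrodynamicLimit.Theses.OneFlightGossipEngine

/-!
# Window functionals split: Cauchy–Schwarz reduction of `KineticCurrentsWindowLD` to its parts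

Route `OneFlightGossipEngine`, items stmt-AtomisticToContinuum-9530 (`KineticCurrentsWindowLD`) /
stmt-AtomisticToContinuum-14662. The functional class is a SUM `F = F_A + F_b` (traceless stress
`F_A = A(x):w⊗w`, delivered by the gossip identity, and radial-odd part `F_b = (b(x)·w)G(x,|w|²)`,
delivered by the Kac heat-flux damping). This file records the generic bookkeeping that lets a line
treat the two parts separately:

* `intervalIntegrable_comp_orbit` — a continuous observable along a good orbit is interval integrable
  (the orbit is measurable in time and stays in the compact `𝕋³ × B(0, √(2E))` of each factor);
* `window_integral_add` — additivity of the window integral along good orbits;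
* `lintegral_exp_add_le_sqrt` — Cauchy–Schwarz `∫e^{X+Y} ≤ (∫e^{2X})^{1/2}(∫e^{2Y})^{1/2}` in `ℝ≥0∞`;
* `lintegral_exp_window_add_le` — hence the window exponential moment of `F₁ + F₂` at `β` is bounded by
  the geometric mean of those of `F₁`, `F₂` at `2β`; in particular window-LD bounds `exp(ε(N+1))` for the
  parts at `2β` give `exp(ε(N+1))` for the sum at `β`.

References: Olla–Varadhan–Yau, Comm. Math. Phys. 155 (1993) 523, §2 (exponential-moment currency).
-/

noncomputable section

open MeasureTheory Real
open scoped ENNReal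

namespace Summit.AtomisticToContinuum.HydrodynamicLimit.Theorems

open Literature.Analysis.FluidPDE Literature.MathematicalPhysics.KineticTheory

/-- **A continuous observable along a good orbit is interval integrable.** The orbit `r ↦ Φ_r z i` is
measurable (`IsHardSphereTrajectory.measurable_torus`) and takes values in the compact set
`univ ×ˢ closedBall 0 √(2E(z))` (energy conservation), on which a continuous `F` is bounded. [folklore] -/
theorem intervalIntegrable_comp_orbit {ε : ℝ} {n : ℕ}
    (Φ : HardSphereFlow (Torus.geometry (Fin 3)) ε n) {z : Config n (Fin 3) T3} (hz : z ∈ Φ.good)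
    {F : T3 × V3 → ℝ} (hF : Continuous F) (i : Fin n) (a b : ℝ) :
    IntervalIntegrable (fun r => F (Φ.flow r z i)) volume a b := by
  have hγ : Measurable fun t => Φ.flow t z := (Φ.isTrajectory z hz).measurable_torus
  have hm : Measurable fun r => F (Φ.flow r z i) := hF.measurable.comp ((measurable_pi_apply i).comp hγ)
  -- the orbit of particle `i` stays in a compact set
  set K : Set (T3 × V3) := Set.univ ×ˢ Metric.closedBall (0 : V3) (Real.sqrt (2 * configEnergy z))
  have hK : IsCompact K := isCompact_univ.prod (isCompact_closedBall _ _)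
  have hmem : ∀ r, Φ.flow r z i ∈ K := by
    intro r
    refine ⟨Set.mem_univ _, ?_⟩
    rw [Metric.mem_closedBall, dist_zero_right]
    refine Real.le_sqrt_of_sq_le ?_
    exact (norm_vel_sq_le_two_mul_configEnergy _ i).trans_eq (by rw [Φ.configEnergy_flow hz r])
  obtain ⟨B, hB⟩ := hK.exists_bound_of_continuousOn hF.continuousOn
  refine (intervalIntegrable_const (c := B)).mono_fun' hm.aestronglyMeasurable
    (ae_of_all _ fun r => ?_)
  exact hB _ (hmem r)

/-- **Additivity of the window integral along good orbits** for continuous observables. [folklore] -/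
theorem window_integral_add {ε : ℝ} {n : ℕ}
    (Φ : HardSphereFlow (Torus.geometry (Fin 3)) ε n) {z : Config n (Fin 3) T3} (hz : z ∈ Φ.good)
    {F₁ F₂ : T3 × V3 → ℝ} (hF₁ : Continuous F₁) (hF₂ : Continuous F₂) (w : ℝ) :
    ∑ i, w⁻¹ * ∫ r in (0 : ℝ)..w, (F₁ (Φ.flow r z i) + F₂ (Φ.flow r z i)) =
      (∑ i, w⁻¹ * ∫ r in (0 : ℝ)..w, F₁ (Φ.flow r z i)) +
        ∑ i, w⁻¹ * ∫ r in (0 : ℝ)..w, F₂ (Φ.flow r z i) := by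
  rw [← Finset.sum_add_distrib]
  refine Finset.sum_congr rfl fun i _ => ?_
  rw [intervalIntegral.integral_add (intervalIntegrable_comp_orbit Φ hz hF₁ i 0 w)
    (intervalIntegrable_comp_orbit Φ hz hF₂ i 0 w)]
  ring

/-- **Cauchy–Schwarz for exponential moments** in `ℝ≥0∞`:
`∫ e^{X+Y} dμ ≤ (∫ e^{2X} dμ)^{1/2} (∫ e^{2Y} dμ)^{1/2}` for a.e.-measurable real `X, Y`. [folklore] -/
theorem lintegral_exp_add_le_sqrt {Ω : Type*} [MeasurableSpace Ω] {μ : Measure Ω} {X Y : Ω → ℝ}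
    (hX : AEMeasurable X μ) (hY : AEMeasurable Y μ) :
    ∫⁻ ω, ENNReal.ofReal (Real.exp (X ω + Y ω)) ∂μ ≤
      (∫⁻ ω, ENNReal.ofReal (Real.exp (2 * X ω)) ∂μ) ^ (1 / 2 : ℝ) *
        (∫⁻ ω, ENNReal.ofReal (Real.exp (2 * Y ω)) ∂μ) ^ (1 / 2 : ℝ) := by
  have hpq : Real.HolderConjugate 2 2 := Real.HolderConjugate.two_two
  have h := ENNReal.lintegral_mul_le_Lp_mul_Lq μ hpq
    (f := fun ω => ENNReal.ofReal (Real.exp (X ω))) (g := fun ω => ENNReal.ofReal (Real.exp (Y ω)))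
    (Real.measurable_exp.comp_aemeasurable hX).ennreal_ofReal
    (Real.measurable_exp.comp_aemeasurable hY).ennreal_ofReal
  have hsq : ∀ (Z : Ω → ℝ) (ω : Ω), ENNReal.ofReal (Real.exp (Z ω)) ^ (2 : ℝ) =
      ENNReal.ofReal (Real.exp (2 * Z ω)) := by
    intro Z ω
    rw [show (2 : ℝ) = ((2 : ℕ) : ℝ) by norm_num, ENNReal.rpow_natCast,
      ← ENNReal.ofReal_pow (Real.exp_nonneg _), ← Real.exp_nat_mul, Nat.cast_ofNat]
  simp only [Pi.mul_apply, hsq] at h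
  refine le_trans (le_of_eq ?_) h
  refine lintegral_congr fun ω => ?_
  rw [Real.exp_add, ENNReal.ofReal_mul (Real.exp_nonneg _)]

/-- **Window exponential moments split.** For a law `μ` carried by the good set of a hard-sphere flow
on `𝕋³` (e.g. any local Gibbs law), continuous observables `F₁, F₂`, a window `w` and `β`:
`∫ exp(β ∑ᵢ w⁻¹∫₀ʷ (F₁+F₂)) dμ ≤ (∫ exp(2β ∑ᵢ w⁻¹∫₀ʷ F₁) dμ)^{1/2} (∫ exp(2β ∑ᵢ w⁻¹∫₀ʷ F₂) dμ)^{1/2}`.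
So finite-kinetic-window LD bounds `exp(ε(N+1))` for the traceless-stress part and for the
radial-odd part of the items' class at parameter `2β` give the bound `exp(ε(N+1))` for the whole
functional at `β`. [folklore] -/
theorem lintegral_exp_window_add_le {ε : ℝ} {n : ℕ}
    (Φ : HardSphereFlow (Torus.geometry (Fin 3)) ε n) {μ : Measure (Config n (Fin 3) T3)}
    (hμ : μ Φ.goodᶜ = 0) {F₁ F₂ : T3 × V3 → ℝ} (hF₁ : Continuous F₁) (hF₂ : Continuous F₂)
    (w β : ℝ) :
    ∫⁻ z, ENNReal.ofReal (Real.exp (β * ∑ i, w⁻¹ * ∫ r in (0 : ℝ)..w,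
        (F₁ (Φ.flow r z i) + F₂ (Φ.flow r z i)))) ∂μ ≤
      (∫⁻ z, ENNReal.ofReal (Real.exp (2 * (β * ∑ i, w⁻¹ * ∫ r in (0 : ℝ)..w,
          F₁ (Φ.flow r z i)))) ∂μ) ^ (1 / 2 : ℝ) *
        (∫⁻ z, ENNReal.ofReal (Real.exp (2 * (β * ∑ i, w⁻¹ * ∫ r in (0 : ℝ)..w,
          F₂ (Φ.flow r z i)))) ∂μ) ^ (1 / 2 : ℝ) := by
  -- a.e.-measurability of the two window functionals
  have hWm : ∀ {F : T3 × V3 → ℝ}, Continuous F →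
      AEMeasurable (fun z => β * ∑ i, w⁻¹ * ∫ r in (0 : ℝ)..w, F (Φ.flow r z i)) μ := by
    intro F hF
    refine AEMeasurable.const_mul (Finset.aemeasurable_fun_sum _ fun i _ => ?_) β
    exact (Φ.aemeasurable_intervalIntegral_comp_flow_torus
      (hF.measurable.comp (measurable_pi_apply i)) 0 w hμ).const_mul _
  have hae : ∀ᵐ z ∂μ, ENNReal.ofReal (Real.exp (β * ∑ i, w⁻¹ * ∫ r in (0 : ℝ)..w,
      (F₁ (Φ.flow r z i) + F₂ (Φ.flow r z i)))) =
      ENNReal.ofReal (Real.exp ((β * ∑ i, w⁻¹ * ∫ r in (0 : ℝ)..w, F₁ (Φ.flow r z i)) +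
        β * ∑ i, w⁻¹ * ∫ r in (0 : ℝ)..w, F₂ (Φ.flow r z i))) := by
    have hgood : ∀ᵐ z ∂μ, z ∈ Φ.good := measure_eq_zero_iff_ae_notMem.1 hμ |>.mono fun z hz => by
      simpa using hz
    filter_upwards [hgood] with z hz
    rw [window_integral_add Φ hz hF₁ hF₂ w, mul_add]
  rw [lintegral_congr_ae hae]
  exact lintegral_exp_add_le_sqrt (hWm hF₁) (hWm hF₂)

end Summit.AtomisticToContinuum.HydrodynamicLimit.Theorems

end
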